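import Literature.NumberTheory.GelbartRogawski1991.DoubledUnitaryAdaptedRelations
import Mathlib.LinearAlgebra.Matrix.NonsingularInverse
import Mathlib.Tactic.NoncommRing
import HarnessLib

/-!
# `Δ`-adapted block coordinates on `U(𝕍 ⊕ −𝕍)`, III: the matrix of the Leray transverse form on the big cell
# ([Kudla1994, §3]; [HarrisKudlaSweet1996, §1 (1.14)–(1.16)])

Topic `NumberTheory/GelbartRogawski1991`; namespace `Literature.NumberTheory.GelbartRogawski1991.AdaptedBlocks`
(sequel of `DoubledUnitaryAdaptedRelations`).  KERNEL ONLY: matrix algebra over an arbitrary commutative ring `L` with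
`2` invertible and a ring endomorphism `σ`; no named fact, no `sorry`.

For `a, b ∈ U(σ, T ⊕ −T)` with adapted blocks `A_a, B_a, C_a, D_a`, … and `ab` in the big cell (`C_{ab}` invertible),
the Leray invariant of the three Lagrangians `(Δ, aΔ, abΔ)` is computed ([Kudla1994, §3], [LionVergne1980, 1.5.4]) by
decomposing `a · (z, z) = (W z, 0)_Δ + ab · (y, y)`, `y = C_{ab}⁻¹ C_a z`, `W = A_a − A_{ab} C_{ab}⁻¹ C_a`; the
transverse form is then `z ↦ im (2 · zᴴ P z)` with

  **`P = Wᴴ T C_a`**,  and this file proves  **`P = −(C_b C_{ab}⁻¹ C_a)ᴴ T`** (`transverseMatrix_eq`)  and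
  **`Pᴴ = −P`** (`cstar_transverseMatrix`),

using only the unitarity relations `Cᴴ T A + Aᴴ T C = 0` (for `a` and for `ab`), `Dᴴ T A + Bᴴ T C = T` (for `a`)
and the product rules `A_{ab} = A_a A_b + B_a C_b`, `C_{ab} = C_a A_b + D_a C_b`.  Consequently the transverse form is
the restriction of scalars of the hermitian matrix `δ⁻¹ · 2P` whose determinant is
`(−2)ⁿ δ⁻ⁿ det T · σ(det C_a · det C_b / det C_{ab})` — the source of Kudla's character values `χ(x(g))`.

## References

* S. S. Kudla, Israel J. Math. 87 (1994) 361–401, §3 [Kudla1994].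
* M. Harris, S. S. Kudla, W. J. Sweet, J. Amer. Math. Soc. 9 (1996) 941–1004, §1 (1.14)–(1.16) [HarrisKudlaSweet1996].
* G. Lion, M. Vergne, *The Weil representation, Maslov index and theta series* (1980), §1.5.4 [LionVergne1980].
-/

set_option autoImplicit false

open Matrix

namespace Literature.NumberTheory.GelbartRogawski1991.AdaptedBlocks

variable {L : Type*} [CommRing L] {ι : Type*} [Fintype ι] [DecidableEq ι] [Invertible (2 : L)]
  {σ : L →+* L} {T : Matrix ι ι L}

omit [DecidableEq ι] [Invertible (2 : L)] in
/-- conjugate-transpose algebra: `σ((X Y))ᵀ = σ(Y)ᵀ σ(X)ᵀ`. [cite: HarrisKudlaSweet1996, §1 (1.11)] -/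
theorem cstar_mul' (X Y : Matrix ι ι L) : ((X * Y).map σ)ᵀ = (Y.map σ)ᵀ * (X.map σ)ᵀ := by
  rw [Matrix.map_mul, Matrix.transpose_mul]

omit [Fintype ι] [DecidableEq ι] [Invertible (2 : L)] in
/-- `σ((X + Y))ᵀ = σ(X)ᵀ + σ(Y)ᵀ`. [cite: HarrisKudlaSweet1996, §1 (1.11)] -/
theorem cstar_add' (X Y : Matrix ι ι L) : ((X + Y).map σ)ᵀ = (X.map σ)ᵀ + (Y.map σ)ᵀ := by
  rw [Matrix.map_add _ (map_add σ), Matrix.transpose_add]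

omit [Fintype ι] [DecidableEq ι] [Invertible (2 : L)] in
/-- `σ((X − Y))ᵀ = σ(X)ᵀ − σ(Y)ᵀ`. [cite: HarrisKudlaSweet1996, §1 (1.11)] -/
theorem cstar_sub' (X Y : Matrix ι ι L) : ((X - Y).map σ)ᵀ = (X.map σ)ᵀ - (Y.map σ)ᵀ := by
  rw [Matrix.map_sub _ (map_sub σ), Matrix.transpose_sub]

omit [Fintype ι] [DecidableEq ι] [Invertible (2 : L)] in
/-- `σ((−X))ᵀ = −σ(X)ᵀ`. [cite: HarrisKudlaSweet1996, §1 (1.11)] -/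
theorem cstar_neg' (X : Matrix ι ι L) : ((-X).map σ)ᵀ = -(X.map σ)ᵀ := by
  rw [Matrix.map_neg _ (map_neg σ), Matrix.transpose_neg]

omit [Invertible (2 : L)] in
/-- for an invertible `X`, `σ(X⁻¹)ᵀ · σ(X)ᵀ = 1`. [cite: HarrisKudlaSweet1996, §1 (1.11)] -/
theorem cstar_inv_mul_cstar {X : Matrix ι ι L} (hX : IsUnit X.det) : (X⁻¹.map σ)ᵀ * (X.map σ)ᵀ = 1 := by
  rw [← cstar_mul', Matrix.mul_nonsing_inv X hX, Matrix.map_one σ (map_zero σ) (map_one σ), Matrix.transpose_one]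

omit [Invertible (2 : L)] in
/-- for an invertible `X`, `σ(X)ᵀ · σ(X⁻¹)ᵀ = 1`. [cite: HarrisKudlaSweet1996, §1 (1.11)] -/
theorem cstar_mul_cstar_inv {X : Matrix ι ι L} (hX : IsUnit X.det) : (X.map σ)ᵀ * (X⁻¹.map σ)ᵀ = 1 := by
  rw [← cstar_mul', Matrix.nonsing_inv_mul X hX, Matrix.map_one σ (map_zero σ) (map_one σ), Matrix.transpose_one]

/-- **Kudla's transverse matrix** `P(a, ab) = Wᴴ T C_a`, `W = A_a − A_{ab} C_{ab}⁻¹ C_a`: the matrix of the Leray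
transverse form of `(Δ, aΔ, abΔ)` in the parametrisation `z ↦ a(z, z)`. [cite: Kudla1994, §3] -/
noncomputable def transverseMatrix (T : Matrix ι ι L) (σ : L →+* L) (M P : Matrix (ι ⊕ ι) (ι ⊕ ι) L) : Matrix ι ι L :=
  ((blkA M - blkA P * (blkC P)⁻¹ * blkC M).map σ)ᵀ * T * blkC M

/-- **`P(a, ab) = −(C_b C_{ab}⁻¹ C_a)ᴴ T`** for `a, ab = a·b ∈ U(σ, T ⊕ −T)` with `C_{ab}` invertible: from
`A_{ab}ᴴ T C_a = C_bᴴ T − C_{ab}ᴴ T A_a` (product rules + `Cᴴ T A + Aᴴ T C = 0`, `Dᴴ T A + Bᴴ T C = T` for `a`).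
[cite: Kudla1994, §3; HarrisKudlaSweet1996, §1 (1.14)] -/
theorem transverseMatrix_eq {M N : Matrix (ι ⊕ ι) (ι ⊕ ι) L}
    (hM : (M.map σ)ᵀ * Matrix.fromBlocks T 0 0 (-T) * M = Matrix.fromBlocks T 0 0 (-T))
    (hC : IsUnit (blkC (M * N)).det) :
    transverseMatrix T σ M (M * N) = -(((blkC N * (blkC (M * N))⁻¹ * blkC M).map σ)ᵀ * T) := by
  have r11 := rel₁₁ hM
  have r21 := rel₂₁ hM
  -- `A_{ab}ᴴ T C_a = C_bᴴ T − C_{ab}ᴴ T A_a`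
  have key : ((blkA (M * N)).map σ)ᵀ * T * blkC M =
      ((blkC N).map σ)ᵀ * T - ((blkC (M * N)).map σ)ᵀ * T * blkA M := by
    rw [blkA_mul, blkC_mul, cstar_add', cstar_add', cstar_mul', cstar_mul', cstar_mul', cstar_mul']
    have e1 : ((blkA N).map σ)ᵀ * ((blkA M).map σ)ᵀ * T * blkC M =
        -(((blkA N).map σ)ᵀ * ((blkC M).map σ)ᵀ * T * blkA M) := by
      have := congrArg (fun X => ((blkA N).map σ)ᵀ * X) r11
      simp only [Matrix.mul_add, Matrix.mul_zero] at this
      rw [Matrix.mul_assoc, Matrix.mul_assoc, ← Matrix.mul_assoc ((blkA M).map σ)ᵀ, eq_neg_of_add_eq_zero_right this]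
      simp only [Matrix.mul_assoc]
    have e2 : ((blkC N).map σ)ᵀ * ((blkB M).map σ)ᵀ * T * blkC M =
        ((blkC N).map σ)ᵀ * T - ((blkC N).map σ)ᵀ * ((blkD M).map σ)ᵀ * T * blkA M := by
      have := congrArg (fun X => ((blkC N).map σ)ᵀ * X) r21
      simp only [Matrix.mul_add] at this
      rw [Matrix.mul_assoc, Matrix.mul_assoc, ← Matrix.mul_assoc ((blkB M).map σ)ᵀ, eq_sub_of_add_eq' this]
      simp only [Matrix.mul_assoc]
    rw [Matrix.add_mul, Matrix.add_mul, e1, e2, Matrix.add_mul, Matrix.add_mul]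
    simp only [Matrix.mul_assoc]
    abel
  have hinv : (((blkC (M * N))⁻¹).map σ)ᵀ * ((blkC (M * N)).map σ)ᵀ = 1 := cstar_inv_mul_cstar hC
  have e4 : ((blkA M).map σ)ᵀ * T * blkC M = -(((blkC M).map σ)ᵀ * T * blkA M) := eq_neg_of_add_eq_zero_right r11
  unfold transverseMatrix
  rw [cstar_sub', cstar_mul', cstar_mul', cstar_mul', cstar_mul']
  calc (((blkA M).map σ)ᵀ - ((blkC M).map σ)ᵀ * ((((blkC (M * N))⁻¹).map σ)ᵀ * ((blkA (M * N)).map σ)ᵀ)) * T *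
        blkC M
      = ((blkA M).map σ)ᵀ * T * blkC M -
          ((blkC M).map σ)ᵀ * (((blkC (M * N))⁻¹).map σ)ᵀ * (((blkA (M * N)).map σ)ᵀ * T * blkC M) := by
        noncomm_ring
    _ = -(((blkC M).map σ)ᵀ * T * blkA M) -
          ((blkC M).map σ)ᵀ * (((blkC (M * N))⁻¹).map σ)ᵀ *
            (((blkC N).map σ)ᵀ * T - ((blkC (M * N)).map σ)ᵀ * T * blkA M) := by rw [e4, key]
    _ = -(((blkC M).map σ)ᵀ * T * blkA M) - ((blkC M).map σ)ᵀ * (((blkC (M * N))⁻¹).map σ)ᵀ * ((blkC N).map σ)ᵀ * T +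
          ((blkC M).map σ)ᵀ * ((((blkC (M * N))⁻¹).map σ)ᵀ * ((blkC (M * N)).map σ)ᵀ) * T * blkA M := by
        noncomm_ring
    _ = -(((blkC M).map σ)ᵀ * ((((blkC (M * N))⁻¹).map σ)ᵀ * ((blkC N).map σ)ᵀ) * T) := by
        rw [hinv, Matrix.mul_one]; noncomm_ring

/-- **`P(a, ab)` is skew-hermitian**: `σ(P)ᵀ = −P`, from `Cᴴ T A + Aᴴ T C = 0` for `a` and for `ab` (the isotropy of
`aΔ` and `abΔ`); here `T` is `σ`-fixed and symmetric. [cite: Kudla1994, §3; HarrisKudlaSweet1996, §1 (1.14)] -/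
theorem cstar_transverseMatrix {M N : Matrix (ι ⊕ ι) (ι ⊕ ι) L} (hT : T.map σ = T) (hTs : Tᵀ = T)
    (hM : (M.map σ)ᵀ * Matrix.fromBlocks T 0 0 (-T) * M = Matrix.fromBlocks T 0 0 (-T))
    (hMN : ((M * N).map σ)ᵀ * Matrix.fromBlocks T 0 0 (-T) * (M * N) = Matrix.fromBlocks T 0 0 (-T))
    (hσ : ∀ x, σ (σ x) = x) (hC : IsUnit (blkC (M * N)).det) :
    ((transverseMatrix T σ M (M * N)).map σ)ᵀ = -transverseMatrix T σ M (M * N) := by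
  have r11 := rel₁₁ hM
  have r11' := rel₁₁ hMN
  have hTT : (T.map σ)ᵀ = T := by rw [hT, hTs]
  have mapmap : ∀ X : Matrix ι ι L, ((X.map σ)ᵀ.map σ)ᵀ = X := fun X => by
    ext i j; simp only [Matrix.transpose_apply, Matrix.map_apply, hσ]
  set W := blkA M - blkA (M * N) * (blkC (M * N))⁻¹ * blkC M with hW
  -- isotropy of `W` against `C_a`: `C_aᴴ T W + Wᴴ T C_a = 0`
  have iso : ((blkC M).map σ)ᵀ * T * W + (W.map σ)ᵀ * T * blkC M = 0 := by
    have h2 : ((blkC M).map σ)ᵀ * T * (blkA (M * N) * (blkC (M * N))⁻¹ * blkC M) +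
        ((blkA (M * N) * (blkC (M * N))⁻¹ * blkC M).map σ)ᵀ * T * blkC M = 0 := by
      -- conjugate `rel₁₁` of `ab` by `C_{ab}⁻¹ C_a`
      set Y := (blkC (M * N))⁻¹ * blkC M with hY
      have hCY : blkC (M * N) * Y = blkC M := by
        rw [hY, ← Matrix.mul_assoc, Matrix.mul_nonsing_inv _ hC, Matrix.one_mul]
      have := congrArg (fun X => (Y.map σ)ᵀ * X * Y) r11'
      simp only [Matrix.mul_add, Matrix.add_mul, Matrix.mul_zero, Matrix.zero_mul] at this
      have eA : blkA (M * N) * (blkC (M * N))⁻¹ * blkC M = blkA (M * N) * Y := by rw [hY, Matrix.mul_assoc]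
      rw [eA, cstar_mul']
      calc ((blkC M).map σ)ᵀ * T * (blkA (M * N) * Y) + (Y.map σ)ᵀ * ((blkA (M * N)).map σ)ᵀ * T * blkC M
          = (Y.map σ)ᵀ * (((blkC (M * N)).map σ)ᵀ * T * blkA (M * N)) * Y +
            (Y.map σ)ᵀ * (((blkA (M * N)).map σ)ᵀ * T * blkC (M * N)) * Y := by
            rw [← hCY, cstar_mul']; simp only [Matrix.mul_assoc]
        _ = 0 := this
    rw [hW, cstar_sub', Matrix.mul_sub, Matrix.sub_mul, Matrix.sub_mul]
    calc ((blkC M).map σ)ᵀ * T * blkA M - ((blkC M).map σ)ᵀ * T * (blkA (M * N) * (blkC (M * N))⁻¹ * blkC M) +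
          (((blkA M).map σ)ᵀ * T * blkC M - ((blkA (M * N) * (blkC (M * N))⁻¹ * blkC M).map σ)ᵀ * T * blkC M)
        = (((blkC M).map σ)ᵀ * T * blkA M + ((blkA M).map σ)ᵀ * T * blkC M) -
            (((blkC M).map σ)ᵀ * T * (blkA (M * N) * (blkC (M * N))⁻¹ * blkC M) +
              ((blkA (M * N) * (blkC (M * N))⁻¹ * blkC M).map σ)ᵀ * T * blkC M) := by abel
      _ = 0 := by rw [r11, h2, sub_zero]
  unfold transverseMatrix
  rw [← hW, cstar_mul', cstar_mul', hTT, mapmap, ← Matrix.mul_assoc]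
  exact eq_neg_of_add_eq_zero_left iso

end Literature.NumberTheory.GelbartRogawski1991.AdaptedBlocks
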